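import Mathlib
import HarnessLib
import Literature.Geometry.Symplectic.SteinDomain
import Literature.Geometry.Symplectic.SteinBoundaryContact
import Literature.Geometry.Symplectic.PlanarContactBoundary
import Literature.Topology.FourManifolds.Morse
import Literature.Topology.FourManifolds.LickorishWallace

/-!
# Sketch — first lemmas for crux-idea cards on `ConvexBisection.PlanarBisectionRigidity`
(item stmt-SmoothPoincare4-10511), ideator 2, round 1.

* `ThinHandlePresentation` — card `heegaard-morse-thin-multisection`: the Heegaard–Morse
  suspension of a planar Stein bisection is a THIN `2(k-1)`-section of genus `k-1`
  (Islambouli–Naylor), whose first checkable shadow in existing vocabulary is the balanced handle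
  presentation `(1, k-1, 2(k-1), k-1, 1)` with `k` the number of binding components of the
  planar supporting open book of the seam (Islambouli–Naylor, Cor. 3.3).
* `SeamHeegaardSplitting` — same card, support: the seam carries the genus-`(k-1)` open-book
  Heegaard splitting whose two handlebodies are the corner cross-section of the multisection.

Nothing here is proved; the point is that the statements elaborate over existing declarations.
The hypothesis block is the crux's (`PlanarBisectionRigidity`, rev 2) with the existential
`PlanarContactBoundary J₁` opened up into an explicit boundary datum `b₁` and open book `ob`
(`planarContactBoundary_iff`), so that the conclusion can mention `ob.k`.
-/

noncomputable section

open scoped Manifold ContDiff Topology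
open Set ContinuousMap

namespace Summit.SmoothPoincare4.SmoothPoincare4.Cruxes.PlanarBisectionRigidity.Ideas

open Literature.Geometry.Symplectic Literature.Topology.FourManifolds

local notation "𝔼 " n:arg => EuclideanSpace ℝ (Fin n)
local notation "𝕊 " n:arg => (Metric.sphere (0 : EuclideanSpace ℝ (Fin (n + 1))) 1)

/-- **Thin handle presentation** (card `heegaard-morse-thin-multisection`, First lemma).
Let `M ≃ₕ S⁴` carry a Stein bisection along a common contact seam, `(W₁,J₁) ∪ (W₂,J₂)`, whose seam
contact structure is supported by a planar open book `ob` with `k = ob.k` binding components.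
Then `M` admits a Morse function with exactly one minimum, `k - 1` critical points of index `1`,
`2(k - 1)` of index `2`, `k - 1` of index `3` and one maximum — the handle presentation read off the
thin `2(k-1)`-section of genus `k - 1` given by `arg ∘ Π` (central surface = double of the page,
sectors = the Lefschetz points of the two halves; Islambouli–Naylor arXiv:2010.03057 Cor. 3.3).
For `k = 1` (seam `S³`, disc pages) this is a Morse function with two critical points (Reeb:
`M ≅ S⁴`, the `SphereSeamStandard` endpoint). Inputs: Wendl arXiv:0806.3193 Thm 1 (both halves are
planar Lefschetz fibrations over `ob`), `χ`-count `n± = k - 1`, planar arc-duality. -/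
def ThinHandlePresentation : Prop :=
  ∀ (M : Type) [TopologicalSpace M] [T2Space M] [SecondCountableTopology M]
    [ChartedSpace (EuclideanSpace ℝ (Fin 4)) M] [IsManifold (𝓡 4) ∞ M],
    M ≃ₕ Metric.sphere (0 : EuclideanSpace ℝ (Fin 5)) 1 →
    ∀ (W₁ : Type) [TopologicalSpace W₁] [ChartedSpace (EuclideanHalfSpace 4) W₁]
      [IsManifold (𝓡∂ 4) ∞ W₁] [CompactSpace W₁]
      (W₂ : Type) [TopologicalSpace W₂] [ChartedSpace (EuclideanHalfSpace 4) W₂]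
      [IsManifold (𝓡∂ 4) ∞ W₂] [CompactSpace W₂]
      (J₁ : SteinStructure W₁) (J₂ : SteinStructure W₂) (e₁ : W₁ → M) (e₂ : W₂ → M)
      (b₁ : BoundaryData (𝓡∂ 4) W₁ (𝓡 3)) (ob : OpenBook b₁.carrier),
      Manifold.IsSmoothEmbedding (𝓡∂ 4) (𝓡 4) ∞ e₁ →
      Manifold.IsSmoothEmbedding (𝓡∂ 4) (𝓡 4) ∞ e₂ →
      Set.range e₁ ∪ Set.range e₂ = Set.univ →
      Set.range e₁ ∩ Set.range e₂ = e₁ '' (𝓡∂ 4).boundary W₁ →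
      Set.range e₁ ∩ Set.range e₂ = e₂ '' (𝓡∂ 4).boundary W₂ →
      (∀ w₁ w₂, e₁ w₁ = e₂ w₂ →
        Submodule.map (mfderiv (𝓡∂ 4) (𝓡 4) e₁ w₁).toLinearMap (contactPlane J₁.J w₁) =
          Submodule.map (mfderiv (𝓡∂ 4) (𝓡 4) e₂ w₂).toLinearMap (contactPlane J₂.J w₂)) →
      ob.IsPlanar → ob.Supports (boundaryPlaneField J₁.J b₁) →
      ∃ f : M → ℝ, IsMorse (𝓡 4) f ∧
        (criticalSetOfIndex (𝓡 4) f 0).ncard = 1 ∧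
        (criticalSetOfIndex (𝓡 4) f 1).ncard = ob.k - 1 ∧
        (criticalSetOfIndex (𝓡 4) f 2).ncard = 2 * (ob.k - 1) ∧
        (criticalSetOfIndex (𝓡 4) f 3).ncard = ob.k - 1 ∧
        (criticalSetOfIndex (𝓡 4) f 4).ncard = 1

/-- **Open-book Heegaard splitting of the seam** (card `heegaard-morse-thin-multisection`,
support): under the same hypotheses the seam `b₁.carrier ≅ ∂W₁` is a genus-`(k-1)` Heegaard
splitting `H ∪_f H'` — the two handlebodies `P × [0,½]`, `P × [½,1]` of the planar open book,
which are the two CORNER cross-sections `H₀`, `H_g` of the thin multisection (`g = k - 1`). -/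
def SeamHeegaardSplitting : Prop :=
  ∀ (W₁ : Type) [TopologicalSpace W₁] [ChartedSpace (EuclideanHalfSpace 4) W₁]
      [IsManifold (𝓡∂ 4) ∞ W₁] [CompactSpace W₁] (J₁ : SteinStructure W₁)
      (b₁ : BoundaryData (𝓡∂ 4) W₁ (𝓡 3)) (ob : OpenBook b₁.carrier),
      ob.IsPlanar → ob.Supports (boundaryPlaneField J₁.J b₁) →
      ∃ (H : Type) (_ : TopologicalSpace H) (_ : ChartedSpace (EuclideanHalfSpace 3) H)
        (_ : IsManifold (𝓡∂ 3) ∞ H) (H' : Type) (_ : TopologicalSpace H')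
        (_ : ChartedSpace (EuclideanHalfSpace 3) H') (_ : IsManifold (𝓡∂ 3) ∞ H')
        (b : BoundaryData (𝓡∂ 3) H (𝓡 2)) (b' : BoundaryData (𝓡∂ 3) H' (𝓡 2))
        (f : b.carrier ≃ₘ⟮𝓡 2, 𝓡 2⟯ b'.carrier),
        IsHeegaardSplitting (ob.k - 1) b b' f b₁.carrier

end Summit.SmoothPoincare4.SmoothPoincare4.Cruxes.PlanarBisectionRigidity.Ideas

end
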